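import Summits.BirchSwinnertonDyer.BirchSwinnertonDyer.Theses.SchneiderFreeAdditiveX3
import Summits.BirchSwinnertonDyer.BirchSwinnertonDyer.Theorems.SchneiderFreeAdditiveX3AnticycControlAdditiveNoLocalPTorsionOfFacts
import Summits.BirchSwinnertonDyer.Rank1Residual.X11b.LocalPrimaryCohomologyEP
import Literature.NumberTheory.GaloisRepresentations.NumberFieldCdTwoProofs
import HarnessLib

/-!
# Route `SchneiderFreeAdditiveX3`, item `ControlNoLocalPTorsionF` (stmt-BirchSwinnertonDyer-19544) — CLOSED

Regime A of the control corner (the frames with no local `p`-torsion, `t_p = 0`): the rev-9 support item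
`ControlNoLocalPTorsionF` — facts (Poitou–Tate duality for Selmer structures, Poitou–Tate duality for `Ш`,
Brink 2007 Thm. 2) → Kolyvagin → the frame-level control statement — is EXACTLY door-c4 gen 2's
`stub_control_noLocalPTorsion_of_facts` (file `…AnticycControlAdditiveNoLocalPTorsionOfFacts.lean`) with its
two remaining hypotheses discharged by tree theorems: the local Euler–Poincaré characteristic at every
completion (`X11b.LocBridge.localEulerPoincareCharacteristic_adicCompletionEP`, team n1011 row T-EPC) and
`cd_p(Γ_K) ≤ 2` (`fieldCdLE_two_of_numberField_holds`, Serre II §4.4 Prop. 13). This also lands the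
registered stub `stub_regimeA` (by name) of the v4-KF skeleton `3dbdb197…` of crux
`AnticycControlAdditiveKF` (stmt-BirchSwinnertonDyer-19548). CONDITIONAL on the cited facts carried INSIDE the
item's statement; closes nothing about BSD by itself.

References: [JetchevSkinnerWan2017] §3.2–3.3; [Castella2018] Thm. 2.3; [MilneADT2006] I 2.8, 4.10;
[Brink2007] Thm. 2; [Kolyvagin1990] Thm. A; [SerreGaloisCohomology1997] II §4.4 Prop. 13.
-/

set_option linter.dupNamespace false

namespace Summit.BirchSwinnertonDyer.BirchSwinnertonDyer.Theorems.SchneiderFreeAdditiveX3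

/-- **Item `ControlNoLocalPTorsionF` of route `SchneiderFreeAdditiveX3` holds** (regime A of the control
corner, `t_p = 0` frames): door-c4 gen 2's `stub_control_noLocalPTorsion_of_facts` with the local
Euler–Poincaré characteristic and `cd_p ≤ 2` supplied by the tree. CONDITIONAL on the cited facts that are
antecedents of the statement itself. [cite: JetchevSkinnerWan2017, Thm. 3.3.1 (arXiv:1512.06894 p. 11)]
[cite: MilneADT2006, Ch. I, Thm. 4.10 and Thm. 2.8] [cite: Brink2007, Thm. 2] [cite: Kolyvagin1990, Thm. A] -/
theorem controlNoLocalPTorsionF_holds :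
    Summit.BirchSwinnertonDyer.BirchSwinnertonDyer.Theses.SchneiderFreeAdditiveX3.ControlNoLocalPTorsionF := by
  intro hPT hPT2 hBr hKo
  exact stub_control_noLocalPTorsion_of_facts hKo hPT hPT2
    (fun K _ _ v ↦
      Summit.BirchSwinnertonDyer.Rank1Residual.X11b.LocBridge.localEulerPoincareCharacteristic_adicCompletionEP K v)
    Literature.NumberTheory.GaloisRepresentations.fieldCdLE_two_of_numberField_holds hBr

/-- The registered stub `stub_regimeA` of the v4-KF skeleton (crux `AnticycControlAdditiveKF`,
stmt-BirchSwinnertonDyer-19548), which is the item BY NAME. [folklore] -/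
theorem stub_regimeA :
    Summit.BirchSwinnertonDyer.BirchSwinnertonDyer.Theses.SchneiderFreeAdditiveX3.ControlNoLocalPTorsionF :=
  controlNoLocalPTorsionF_holds

end Summit.BirchSwinnertonDyer.BirchSwinnertonDyer.Theorems.SchneiderFreeAdditiveX3
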